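import Literature.NumberTheory.EllipticCurves.BSDSelmerSmithAssumptionProofs
import HarnessLib

/-!
# Smith's Theorem 1.1 (arXiv:2503.17619): decomposition into the three printed inputs that are
# not yet in the tree

Fact-decomposition file (librarian, mode `fact-decompose`, 2026-08-16) for the named fact
`Literature.NumberTheory.EllipticCurves.smith_selmerCorank_density` (`BSDSelmer.lean`, §bsd.S34;
A. Smith, *The Birch and Swinnerton-Dyer conjecture implies Goldfeld's conjecture*,
arXiv:2503.17619 (2025), Thm. 1.1: for every elliptic `E/ℚ` the `2^∞`-Selmer corank of `E^d` is
`0`, `1`, `≥ 2` for densities `1/2`, `1/2`, `0` of squarefree `d`).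

The printed proof ("Proof of Theorem 1.1", §1.1 p. 4, with the proof of Thm. 1.7 in §1.2) is a
case split (Def. 1.6, Cases I–V) whose deductions are ALL PROVED in the tree
(`BSDSelmerSmith*Proofs.lean`: exhaustiveness of the cases, the isogeny trick with Prop. 1.18,
isogeny invariance and the Case III reduction, [Chil21] "Case V ⇒ `E₀` in Case IV", the parity
half from Modularity and Monsky's congruence, and the normalisation `Assumption 1.1 ⇔ Case I ∨ II`),
assembled as `smith_selmerCorank_density_of_smi22a`. Its hypotheses are two EXISTING named facts
(`ModularForms.exists_isNewformOf`, Modularity; `monsky_selmerCorank_two_mod_two_eq`, `2`-parity)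
and three printed theorems of Smith that the tree does not contain — the children of this file:

* `smith2022_selmerCorank_distribution` — A. Smith, arXiv:2207.05674 [Smi22a], **Thm. 1.2**
  under its **Assumption 1.1** (`smi22aAssumption`): the distribution of `r_{2^∞}(E^d)` over
  `d ∈ ℤ^{≠0}`, `|d| ≤ H` ("If `E` is in Case I or Case II, Theorem 1.1 follows for `E` from
  [Smi22a]");
* `smith2025_thm117_caseIV`, `smith2025_thm117_caseV` — arXiv:2503.17619, **Thm. 1.17**, its two
  printed conclusions (Case IV with the balanced isogeny `φ`: for `100 %` of squarefree `d`,
  `r_{2^∞}(E^d) ≤ 1` or `r_{2^∞}(E^d) = r_{φ,div}(E^d) ≥ 2`; Case V with the two balanced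
  isogenies: the three-way alternative), proved in §§2–6 of the source (the modified group ring,
  the bilinearly enhanced Cassels–Tate pairing, Prop. 1.18's companion counts).

`smith_selmerCorank_density_holds_of` PROVES the parent (for every elliptic `E`) from the three
children and the two existing facts. No child restates the parent: [Smi22a] Thm. 1.2 is the
parent's conclusion only for curves satisfying Assumption 1.1 (and over all `d`, not squarefree
`d`), and Thm. 1.17 describes `r_{2^∞}` through `r_{φ,div}` in Cases IV/V, where the parent's
conclusion needs the isogeny trick on top.

## References

* [arXiv250317619] A. Smith, arXiv:2503.17619 (2025): Thm. 1.1, Def. 1.6, Thm. 1.7, §1.1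
  "Proof of Theorem 1.1", §1.2 Def. 1.16, Thm. 1.17, Prop. 1.18.
* [Smith2022SelmerTwistI] A. Smith, *The distribution of `ℓ^∞`-Selmer groups in degree `ℓ` twist
  families I*, arXiv:2207.05674 (2022) = J. Amer. Math. Soc. 39 (2026), no. 1, 1–72,
  doi:10.1090/jams/1062: Assumption 1.1, Thm. 1.2, Thm. 1.5 and the sentence after it ("we derive
  the first and third cases of Theorem 1.2 as a consequence"), Rem. 1.6 ("The variant … that
  applies to elliptic curves satisfying Assumption 1.1 (2) will be given as [Smi22b]").
* [Smith2026SelmerTwistII] A. Smith, *The distribution of `ℓ^∞`-Selmer groups in degree `ℓ` twist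
  families II*, arXiv:2207.05143 = J. Amer. Math. Soc. 39 (2026), no. 2, 453–514,
  doi:10.1090/jams/1063: §1, Example 1.2, Thm. 1.4 and the paragraph after it ("This proves the
  second case of [Smi1, Theorem 1.2]"), Thm. 2.14.
* [Chil21] G. Chiloyan, Á. Lozano-Robledo, Trans. London Math. Soc. 8 (2021) 1–34, Thm. 1.2.

## Publication status of the three children (literature audit, cell `bsd-goldfeld`, 2026-08-25)

`smith2022_selmerCorank_distribution` is REFEREED PRINT in all three branches of Assumption 1.1:
branches (1) and (3) are proved in part I (JAMS 39 (2026) 1–72, from Thm. 1.5), branch (2) — the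
branch met by every `E/ℚ` with `E(ℚ)[2] ≅ ℤ/2ℤ` and a non-balanced `2`-isogeny, e.g. `X₀(49)`
(`cm7`: `ℚ(E[2]) = ℚ(√-7)`, `ℚ(E₀[2]) = ℚ(√7)`) — in part II (JAMS 39 (2026) 453–514, §1,
Thm. 1.4 applied to `A` and `A₀`). `smith2025_thm117_caseIV` / `smith2025_thm117_caseV` rest on the
PREPRINT arXiv:2503.17619 (no journal version found in Crossref/zbMATH on 2026-08-25). Hence for a
curve satisfying Assumption 1.1 (Case I or II) the parent `smith_selmerCorank_density E` follows
from refereed print ALONE — `smith_selmerCorank_density_of_smi22a_printed h22 E hE`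
(`BSDSelmerSmithAssumptionProofs`, §Assembly; no Modularity, no Monsky, no Thm. 1.17) — while
Cases III–V need the preprint children.
-/

noncomputable section

open scoped Classical
open Filter Topology

namespace Literature.NumberTheory.EllipticCurves

open WeierstrassCurve Literature.NumberTheory.EllipticCurves.ModularForms

/-- **[Smi22a] = A. Smith, arXiv:2207.05674, Thm. 1.2 (distribution of `2^∞`-Selmer coranks in
the quadratic twist family of a curve satisfying Assumption 1.1; child 1 of
`smith_selmerCorank_density`).** For every elliptic curve `E/ℚ` satisfying [Smi22a],
Assumption 1.1 (`smi22aAssumption`; equivalently `E` is in Case I or Case II of arXiv:2503.17619,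
Def. 1.6, `smi22aAssumption_iff_smithCaseI_or_smithCaseII`) and every `r ≥ 0`,
`lim_{H → ∞} #{d ∈ ℤ, d ≠ 0, |d| ≤ H : r_{2^∞}(E^d) = r} / (2H) = 1/2` for `r = 0, 1` and `= 0` for
`r ≥ 2` (`r_{2^∞} = selmerCorankTwoInfty`, the `ℤ₂`-corank of `Sel_{2^∞}`). This is the input
"If `E` is in Case I or Case II, Theorem 1.1 follows for `E` from [Smi22a]" of the proof of
Thm. 1.1 of arXiv:2503.17619 (§1.1, p. 4); verbatim the hypothesis `h22` of
`smith_selmerCorank_density_of_smi22a`. Publication status (2026-08-25): REFEREED — part I =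
J. Amer. Math. Soc. 39 (2026), no. 1, 1–72 states Thm. 1.2 under Assumption 1.1 and proves its
branches (1), (3) (from Thm. 1.5: "we derive the first and third cases of Theorem 1.2 as a
consequence"; Rem. 1.6 defers branch (2) to part II); part II = J. Amer. Math. Soc. 39 (2026),
no. 2, 453–514, §1 proves branch (2) (Example 1.2: `A : y² = x(x² + ax + b)`,
`A₀ : y² = x(x² - 2ax + (a² - 4b))`, `K = ℚ(√(a² - 4b))`, `K₀ = ℚ(√b)` "distinct nontrivial
extensions of `ℚ`"; Thm. 1.4 applied to `A` and `A₀`: "This proves the second case of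
[Smi1, Theorem 1.2]"). [cite: Smith2022SelmerTwistI, Thm. 1.2 with Assumption 1.1; Thm. 1.5, Rem. 1.6]
[cite: Smith2026SelmerTwistII, §1, Example 1.2, Thm. 1.4 and the paragraph after it (arXiv p. 3)]
[cite: arXiv250317619, §1.1, proof of Thm. 1.1] -/
def smith2022_selmerCorank_distribution : Prop :=
  ∀ (A : WeierstrassCurve ℚ) [A.IsElliptic], smi22aAssumption A → ∀ r : ℕ,
    Tendsto (fun H : ℕ ↦ (Nat.card {d : ℤ | d ≠ 0 ∧ |d| ≤ (H : ℤ) ∧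
      selmerCorankTwoInfty (A.quadraticTwist d) = r} : ℝ) / (2 * H)) atTop
      (𝓝 (if r ≤ 1 then 1 / 2 else 0))

/-- **A. Smith, arXiv:2503.17619, Thm. 1.17, Case IV conclusion (child 2 of
`smith_selmerCorank_density`).** For an elliptic `E/ℚ` in Case IV (Def. 1.6; models with
`a₁ = a₃ = 0`) and a balanced `ℚ`-isogeny `φ : E → E₀` (`Isogeny.IsBalanced`) with dual `φ'`,
`φ' ∘ φ = [2]`: for `100 %` of squarefree `d` (natural density `1`, `twistDensity … 1`), either
`r_{2^∞}(E^d) ≤ 1` or `r_{2^∞}(E^d) = r_{φ,div}(E^d) ≥ 2` (`Isogeny.twistDivRank`, Def. 1.16 at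
`p = 2`). Verbatim the hypothesis `h17IV` of `smith_selmerCorank_density_of_smi22a`; proved in
§§2–6 of the source. [cite: arXiv250317619, Thm. 1.17 (Case IV) with Def. 1.16] -/
def smith2025_thm117_caseIV : Prop :=
  ∀ (E E₀ : WeierstrassCurve ℚ) [E.IsElliptic] [E₀.IsElliptic] [E.IsCharNeTwoNF]
    [E₀.IsCharNeTwoNF] (φ : Isogeny E E₀) (φ' : Isogeny E₀ E),
    smithCaseIV E → φ.IsBalanced → (∀ P, φ' (φ P) = (2 : ℤ) • P) →
      twistDensity (fun d ↦ d ≠ 0 ∧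
        (selmerCorankTwoInfty (E.quadraticTwist d) ≤ 1 ∨
          (selmerCorankTwoInfty (E.quadraticTwist d) = φ.twistDivRank d ∧
            2 ≤ φ.twistDivRank d))) 1

/-- **A. Smith, arXiv:2503.17619, Thm. 1.17, Case V conclusion (child 3 of
`smith_selmerCorank_density`).** For an elliptic `E/ℚ` in Case V (Def. 1.6; models with
`a₁ = a₃ = 0`) and two balanced `ℚ`-isogenies `φ₁ : E → E₁`, `φ₂ : E → E₂` with distinct kernels:
for `100 %` of squarefree `d`, `r_{2^∞}(E^d) ≤ 1`, or `r_{2^∞}(E^d) = r_{φ₁,div}(E^d) ≥ 2`, or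
`r_{2^∞}(E^d) = r_{φ₂,div}(E^d) ≥ 2`. Verbatim the hypothesis `h17V` of
`smith_selmerCorank_density_of_smi22a`; proved in §§2–6 of the source.
[cite: arXiv250317619, Thm. 1.17 (Case V) with Def. 1.16] -/
def smith2025_thm117_caseV : Prop :=
  ∀ (E E₁ E₂ : WeierstrassCurve ℚ) [E.IsElliptic] [E₁.IsElliptic] [E₂.IsElliptic]
    [E.IsCharNeTwoNF] [E₁.IsCharNeTwoNF] [E₂.IsCharNeTwoNF] (φ₁ : Isogeny E E₁)
    (φ₂ : Isogeny E E₂),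
    smithCaseV E → φ₁.IsBalanced → φ₂.IsBalanced →
      φ₁.toAddMonoidHom.ker ≠ φ₂.toAddMonoidHom.ker →
      twistDensity (fun d ↦ d ≠ 0 ∧
        (selmerCorankTwoInfty (E.quadraticTwist d) ≤ 1 ∨
          (selmerCorankTwoInfty (E.quadraticTwist d) = φ₁.twistDivRank d ∧
            2 ≤ φ₁.twistDivRank d) ∨
          (selmerCorankTwoInfty (E.quadraticTwist d) = φ₂.twistDivRank d ∧
            2 ≤ φ₂.twistDivRank d))) 1

/-- **Assembly (PROVED): Smith's Thm. 1.1 for every elliptic curve over `ℚ`** from [Smi22a]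
Thm. 1.2, the two conclusions of Thm. 1.17, Modularity (`exists_isNewformOf`) and Monsky's
`2`-parity congruence (`monsky_selmerCorank_two_mod_two_eq`) — the tree's
`smith_selmerCorank_density_of_smi22a` (case split of Def. 1.6, isogeny trick with Prop. 1.18,
[Chil21], normalisation of Assumption 1.1, all proved). [cite: arXiv250317619, Thm. 1.1 (proof, §1.1) and Thm. 1.7 (proof, §1.2)] -/
theorem smith_selmerCorank_density_holds_of (hmod : exists_isNewformOf)
    (hMon : monsky_selmerCorank_two_mod_two_eq) (h22 : smith2022_selmerCorank_distribution)
    (h17IV : smith2025_thm117_caseIV) (h17V : smith2025_thm117_caseV)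
    (E : WeierstrassCurve ℚ) [E.IsElliptic] : smith_selmerCorank_density E :=
  smith_selmerCorank_density_of_smi22a hmod hMon (fun A _ hA ↦ h22 A hA) h17IV h17V E

end Literature.NumberTheory.EllipticCurves

end
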